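import Mathlib
import Summits.Ventures.PercRepro2.V2SP
import Summits.Ventures.PercRepro2.UniversalClosures

/-! # (UH*) on B₃ ∧ B₃ — the first series–parallel network of free edges outside the flow-≤2 theorem, by computation
(seat mine-b, cell pub-perc-repro2; MINE-B.md §23)

`B₃ ∧ B₃` (two three-edge bundles in series, 64 configurations, flow 3) is the smallest network of free edges not
covered by `SP.universal_of_flow_le_two` (UniversalFlow2.lean / UniversalFlow2Good.lean).  Its universal
level-conditioned Hall statement `Universal` is verified here by an explicit assignment of its 21 slots (a table
found by max-flow), checked by `decide +kernel`: the injectivity and the three target conditions are finite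
computations in the kernel (no `native_decide`).  On the way, `SP.confDecLE`: the configuration order of every
series–parallel term is decidable. -/

namespace Summit.Ventures.PercRepro2.V2Closure

open Summit.Ventures.PercRepro2.UHClosure

/-- the bundle of three free edges -/
abbrev SP.bundle3 : SP := SP.par (SP.par SP.free SP.free) SP.free

/-- two three-edge bundles in series -/
abbrev SP.b33 : SP := SP.ser SP.bundle3 SP.bundle3

/-- the assignment table: (source configuration, slot index, target configuration) -/
def b33Table : List (SP.b33.Conf × ℕ × SP.b33.Conf) := [
  ((((false, false), true), ((true, true), true)), 0, (((false, false), false), ((false, true), true))),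
  ((((false, true), false), ((true, true), true)), 0, (((false, false), false), ((true, false), true))),
  ((((false, true), true), ((true, true), true)), 0, (((false, false), true), ((false, true), true))),
  ((((false, true), true), ((true, true), true)), 1, (((false, false), true), ((true, false), true))),
  ((((true, false), false), ((true, true), true)), 0, (((false, false), false), ((true, true), false))),
  ((((true, false), true), ((true, true), true)), 0, (((false, false), true), ((true, true), false))),
  ((((true, false), true), ((true, true), true)), 1, (((true, false), false), ((false, true), true))),
  ((((true, true), false), ((true, true), true)), 0, (((false, true), false), ((false, true), true))),
  ((((true, true), false), ((true, true), true)), 1, (((false, true), false), ((true, false), true))),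
  ((((true, true), true), ((false, false), true)), 0, (((false, true), true), ((false, false), false))),
  ((((true, true), true), ((false, true), false)), 0, (((false, true), true), ((false, true), false))),
  ((((true, true), true), ((false, true), true)), 0, (((false, true), true), ((false, false), true))),
  ((((true, true), true), ((false, true), true)), 1, (((false, true), true), ((false, true), true))),
  ((((true, true), true), ((true, false), false)), 0, (((false, true), true), ((true, false), false))),
  ((((true, true), true), ((true, false), true)), 0, (((false, true), true), ((true, false), true))),
  ((((true, true), true), ((true, false), true)), 1, (((true, false), false), ((true, false), true))),
  ((((true, true), true), ((true, true), false)), 0, (((false, true), false), ((true, true), false))),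
  ((((true, true), true), ((true, true), false)), 1, (((false, true), true), ((true, true), false))),
  ((((true, true), true), ((true, true), true)), 0, (((true, false), true), ((false, true), true))),
  ((((true, true), true), ((true, true), true)), 1, (((true, false), true), ((true, false), true))),
  ((((true, true), true), ((true, true), true)), 2, (((true, false), true), ((true, true), false)))
]

/-- the assignment as a function on the slots (table lookup; defaults to the source itself, never used) -/
def b33Assign (p : SlotL (USrc SP.b33.rLab SP.b33.bLab) SP.b33.bLab) : SP.b33.Conf :=
  match b33Table.find? (fun e => e.1 = p.1.1.1 ∧ e.2.1 = p.1.2.val) with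
  | some e => e.2.2
  | none => p.1.1.1

/-- the configuration order of every series–parallel term is decidable (booleans, units, products) -/
@[reducible] def SP.confDecLE : ∀ s : SP, DecidableRel (α := s.Conf) (· ≤ ·)
  | .free => inferInstanceAs (DecidableRel (α := Bool) (· ≤ ·))
  | .pin => inferInstanceAs (DecidableRel (α := Unit) (· ≤ ·))
  | .absent => inferInstanceAs (DecidableRel (α := Unit) (· ≤ ·))
  | .ser s t =>
      let _ := s.confDecLE
      let _ := t.confDecLE
      inferInstanceAs (DecidableRel (α := s.Conf × t.Conf) (· ≤ ·))
  | .par s t =>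
      let _ := s.confDecLE
      let _ := t.confDecLE
      inferInstanceAs (DecidableRel (α := s.Conf × t.Conf) (· ≤ ·))

/-- the configuration order, decidable, as an instance -/
instance (s : SP) : DecidableRel (α := s.Conf) (· ≤ ·) := s.confDecLE

set_option maxRecDepth 20000 in
/-- **(UH*) holds on B₃ ∧ B₃** (kernel computation). -/
theorem SP.universal_b33 : Universal SP.b33.rLab SP.b33.bLab :=
  ⟨b33Assign, by decide +kernel, by decide +kernel⟩

end Summit.Ventures.PercRepro2.V2Closure
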